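import Literature.AnabelianGeometry.AbsoluteAnabelian.GaloisCyclotomeResOpenEmbedding
import Literature.AnabelianGeometry.AbsoluteAnabelian.OpenInjectionFactorsThroughRestriction
import Literature.AnabelianGeometry.AbsoluteAnabelian.AbsTopIII.ReconstructionCor110iaResNaturalProofs
import Literature.AnabelianGeometry.AbsoluteAnabelian.AbsTopIII.ReconstructionCor110ibResNaturalProofs
import Literature.Algebra.Homology.ContCohomologyInnerDegreeOne
import Literature.NumberTheory.GaloisRepresentations.LocalFieldFiniteExtension
import HarnessLib

/-!
# [AbsTopIII] Cor. 1.10 (i)(a)/(b): functoriality in ARBITRARY injective open homomorphisms — the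
# print-literal form, assembled

S. Mochizuki, *Topics in Absolute Anabelian Geometry III*, Cor. 1.10 (i) p. 42 (kurims
`paper:url-5493eb38cbb7`): after the isomorphisms (a) `H²(G_k, μ_Ẑ(G_k)) ⥲ Ẑ`, (b) `H¹(G_k, μ_Ẑ(G_k)) ⥲ G_k^ab`:
«Here, the asserted "functoriality" is with respect to arbitrary injective open homomorphisms of profinite
groups [cf. also Remark 1.10.1, (iii), below]»; Rmk. 1.10.1 (iii) p. 44: for (a) the compatibility holds
«relative to dividing … by a factor given by the index of the image of the induced open homomorphism».

The tree proves the functoriality of THE families (a) `Cor110iaNat.residueIso` (abc-iut-L4-d1) and (b) the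
reciprocity family of `AbsTopIII.cor_1_10_i_b_resNatural_holds` (abc-iut-L4-d3/L4-t11) along ISOMORPHISMS
(`galCyclotomeCohomologyMap α`) and along FIELD RESTRICTIONS `res : G_{k′} ↪ G_k` (`galCyclotomeRes k k′`),
and that every injective open `β : G_{k₁} ↪ G_k` is `Inn(g) ∘ res_{L/k} ∘ α` with `[L : k] = [G_k : β(G_{k₁})]`
(`exists_eq_conj_absGaloisRestrict_comp`).  This PROOF-ONLY file assembles the print-literal statements for
the restriction `Res_β = galCyclotomeResOE β q` along an ARBITRARY injective open `β`
(`GaloisCyclotomeResOpenEmbedding.lean`):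

* `galCyclotomeResOE_one_eq_id_of_forall_eq_conj` / `…_two_…` — along an INNER automorphism `Res_β` is the
  identity on `H¹` / `H²` (Serre, inner automorphisms act trivially: `ContinuousCohomology.map_one_eq_id_of_inner`
  / `map_two_eq_id_of_inner`, the coefficient leg being the cyclotome action `galCyclotomeResOECoeff_of_forall_eq_conj`);
* `galCyclotomeResOE_factorisation_apply` — for `β = Inn(g) ∘ res_{L/k} ∘ α`:
  `Res_β = H^q(α⁻¹) ∘ Res_{L/k}` (`q = 1, 2`);
* **(a) `residueFamily_galCyclotomeResOE`** — ANY family `r_k : H²(G_k, μ_Ẑ(G_k)) ≃ Ẑ` natural in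
  isomorphisms and satisfying the index formula along finite extensions satisfies, for EVERY injective open
  `β : G_{k₁} ↪ G_k`, `r_{k₁} (Res_β x) = [G_k : β(G_{k₁})] · r_k x`; whence **`Cor110iaNat.residueIso_galCyclotomeResOE`**
  for THE family and the packaged **`AbsTopIII.cor_1_10_i_a_openInjective`**;
* **(b) `reciprocityFamily_galCyclotomeResOE`** — ANY family `j_k : H¹(G_k, μ_Ẑ(G_k)) ≃ G_k^ab` natural in
  isomorphisms and restriction/Verlagerung-compatible satisfies, for every injective open `β` and every
  factorisation `β = Inn(g) ∘ res_{L/k} ∘ α`, `j_{k₁} (Res_β x) = (α⁻¹)^ab (Ver_{L/k} (j_k x))`; whence the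
  packaged **`AbsTopIII.cor_1_10_i_b_openInjective`** (four clauses, no hypothesis).

Theorems only (no definition, no named fact, no `sorry`); axioms standard.  HONEST FRAMING: classical
LCFT/Kummer theory and topological group theory; nothing here bears on [IUTchIII] Cor. 3.12 or takes a side.
-/

noncomputable section

open CategoryTheory Function
open Field IntermediateField

universe u

namespace Literature.AnabelianGeometry.AbsoluteAnabelian

open Literature.NumberTheory.GaloisRepresentations
open ProfiniteGrp ProfiniteGrp.ProfiniteCompletion
open Literature.AnabelianGeometry.EtaleTheta.ZHatLevel

/-! ### §1. `Res_β` along an inner automorphism is the identity (degrees 1 and 2) -/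

section Inner

variable {G : Type u} [Group G] [TopologicalSpace G] [IsTopologicalGroup G] [CompactSpace G] [T2Space G]

/-- **`Res_β = 𝟙` on `H¹(G, μ_Ẑ(G))` for an inner automorphism `β : x ↦ τ⁻¹ x τ`.**
[cite: MochizukiAbsTopIII2015, Cor 1.10 (i) p.42] [cite: SerreGaloisCohomology1997, I §2.5] -/
theorem galCyclotomeResOE_one_eq_id_of_forall_eq_conj (τ : G) (φ : G →ₜ* G)
    (hφ : ∀ x, φ x = τ⁻¹ * x * τ) (hinj : Injective φ) (hf : IsOpen (Set.range φ)) :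
    galCyclotomeResOE φ hinj hf 1 = 𝟙 _ := by
  haveI : LocallyCompactSpace G := inferInstance
  exact ContinuousCohomology.map_one_eq_id_of_inner.{0, u, u} (galCyclotomeTopRep G) τ φ hφ
    (galCyclotomeResOECoeff φ hinj hf) (galCyclotomeResOECoeff_of_forall_eq_conj τ φ hφ hinj hf)

/-- **`Res_β = 𝟙` on `H²(G, μ_Ẑ(G))` for an inner automorphism `β : x ↦ τ⁻¹ x τ`.**
[cite: MochizukiAbsTopIII2015, Cor 1.10 (i) p.42] [cite: SerreGaloisCohomology1997, I §2.5] -/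
theorem galCyclotomeResOE_two_eq_id_of_forall_eq_conj (τ : G) (φ : G →ₜ* G)
    (hφ : ∀ x, φ x = τ⁻¹ * x * τ) (hinj : Injective φ) (hf : IsOpen (Set.range φ)) :
    galCyclotomeResOE φ hinj hf 2 = 𝟙 _ := by
  haveI : LocallyCompactSpace G := inferInstance
  exact ContinuousCohomology.map_two_eq_id_of_inner.{0, u, u} (galCyclotomeTopRep G) τ φ hφ
    (galCyclotomeResOECoeff φ hinj hf) (galCyclotomeResOECoeff_of_forall_eq_conj τ φ hφ hinj hf)

end Inner

/-! ### §2. `Res_β` along a factorisation `β = Inn(g) ∘ res_{L/k} ∘ α` -/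

section Factorisation

variable {k : Type u} [Field k] [CharZero k] {H : Type u} [Group H] [TopologicalSpace H]
  [IsTopologicalGroup H] [CompactSpace H] [T2Space H]

/-- **`Res_β = H^q(α⁻¹) ∘ Res_{L/k}` for `β = Inn(g) ∘ res_{L/k} ∘ α`** (`q = 1` or `2`): contravariant
functoriality of `Res`, the inner leg being the identity and the isomorphism leg abc-iut-L4-d1's transport.
[cite: MochizukiAbsTopIII2015, Remark 1.10.1 p.44] -/
theorem galCyclotomeResOE_factorisation_apply (β : H →ₜ* absoluteGaloisGroup k) (hinj : Injective β)
    (hopen : IsOpen (Set.range β)) (L : IntermediateField k (AlgebraicClosure k)) [FiniteDimensional k L]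
    (α : H ≃ₜ* absoluteGaloisGroup L) (g : absoluteGaloisGroup k)
    (hβ : ∀ σ : H, β σ = g * absGaloisRestrict k L (α σ) * g⁻¹) {q : ℕ} (hq : q = 1 ∨ q = 2)
    (x : continuousCohomology q (galCyclotomeTopRep (absoluteGaloisGroup k))) :
    (galCyclotomeResOE β hinj hopen q).hom x =
      galCyclotomeCohomologyMap α.symm q ((galCyclotomeRes k L q).hom x) := by
  -- the three legs as open injections: `φ = Inn(g)`, `ρ = res_{L/k}`, `a = α`
  have hφ : ∀ x, (conjContinuousMulEquiv g : absoluteGaloisGroup k →ₜ* absoluteGaloisGroup k) x =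
      g⁻¹⁻¹ * x * g⁻¹ := fun x => by
    rw [inv_inv]; exact conjContinuousMulEquiv_apply g x
  have hφinj := injective_of_forall_eq_conj g⁻¹ _ hφ
  have hφopen := isOpen_range_of_forall_eq_conj g⁻¹ _ hφ
  have hρinj : Injective (absGaloisRestrict k L) := absGaloisRestrict_injective k L
  have hρopen : IsOpen (Set.range (absGaloisRestrict k L)) := isOpen_range_absGaloisRestrict k L
  have hainj := injective_coe_continuousMulEquiv α.symm.symm
  have haopen := isOpen_range_coe_continuousMulEquiv α.symm.symm
  have h1inj : Injective ((conjContinuousMulEquiv g : absoluteGaloisGroup k →ₜ* absoluteGaloisGroup k).comp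
      (absGaloisRestrict k L)) := hφinj.comp hρinj
  have h1open := isOpen_range_comp_of_isOpen_range hρopen _ hφinj hφopen
  have h2inj : Injective ((((conjContinuousMulEquiv g : absoluteGaloisGroup k →ₜ* absoluteGaloisGroup k).comp
      (absGaloisRestrict k L))).comp (α.symm.symm : H →ₜ* absoluteGaloisGroup L)) := h1inj.comp hainj
  have h2open := isOpen_range_comp_of_isOpen_range haopen _ h1inj h1open
  have hβ' : ∀ σ, β σ = ((((conjContinuousMulEquiv g : absoluteGaloisGroup k →ₜ* absoluteGaloisGroup k).comp
      (absGaloisRestrict k L))).comp (α.symm.symm : H →ₜ* absoluteGaloisGroup L)) σ := fun σ => by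
    rw [hβ σ]; rfl
  rw [galCyclotomeResOE_congr hβ' hinj hopen h2inj h2open q,
    galCyclotomeResOE_comp _ h1inj h1open _ hainj haopen h2inj h2open q,
    galCyclotomeResOE_comp _ hφinj hφopen _ hρinj hρopen h1inj h1open q]
  have hid : galCyclotomeResOE _ hφinj hφopen q = 𝟙 _ := by
    rcases hq with rfl | rfl
    · exact galCyclotomeResOE_one_eq_id_of_forall_eq_conj g⁻¹ _ hφ hφinj hφopen
    · exact galCyclotomeResOE_two_eq_id_of_forall_eq_conj g⁻¹ _ hφ hφinj hφopen
  rw [hid, Category.id_comp, TopModuleCat.hom_comp, ContinuousLinearMap.comp_apply,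
    galCyclotomeResOE_coe_symm_apply α.symm hainj haopen q, ← galCyclotomeRes_eq_galCyclotomeResOE]

end Factorisation

/-! ### §3. (a): the residue family along arbitrary injective open homomorphisms -/

section ResidueFamily

/-- **(a) along ARBITRARY injective open homomorphisms.**  ANY family
`r_k : H²(G_k, μ_Ẑ(G_k)) ≃ Ẑ` (indexed by MLFs) that is natural in isomorphisms of topological groups and
satisfies the index formula `r_{k′} ∘ Res_{k′/k} = [k′ : k] · r_k` along finite extensions satisfies, for EVERY
injective open homomorphism `β : G_{k₁} ↪ G_k`, `r_{k₁} (Res_β x) = [G_k : β(G_{k₁})] · r_k x` — «a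
compatibility relative to dividing … by a factor given by the index of the image of the induced open
homomorphism». [cite: MochizukiAbsTopIII2015, Remark 1.10.1 p.44] -/
theorem residueFamily_galCyclotomeResOE
    (r : ∀ (k : Type) [Field k] [ValuativeRel k] [TopologicalSpace k] [IsNonarchimedeanLocalField k]
      [CharZero k], galCyclotomeH2 (absoluteGaloisGroup k) ≃+ Additive (completion (GrpCat.of (Multiplicative ℤ))))
    (hiso : ∀ (k₁ : Type) [Field k₁] [ValuativeRel k₁] [TopologicalSpace k₁] [IsNonarchimedeanLocalField k₁]
      [CharZero k₁]
      (k₂ : Type) [Field k₂] [ValuativeRel k₂] [TopologicalSpace k₂] [IsNonarchimedeanLocalField k₂]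
      [CharZero k₂]
      (α : absoluteGaloisGroup k₁ ≃ₜ* absoluteGaloisGroup k₂) (x : galCyclotomeH2 (absoluteGaloisGroup k₁)),
      r k₂ (galCyclotomeCohomologyMap α 2 x) = r k₁ x)
    (hres : ∀ (k : Type) [Field k] [ValuativeRel k] [TopologicalSpace k] [IsNonarchimedeanLocalField k]
      [CharZero k]
      (k' : Type) [Field k'] [ValuativeRel k'] [TopologicalSpace k'] [IsNonarchimedeanLocalField k'] [CharZero k']
      [Algebra k k'] [FiniteDimensional k k'] (x : galCyclotomeH2 (absoluteGaloisGroup k)),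
      r k' ((galCyclotomeRes k k' 2).hom x) = (Module.finrank k k') • r k x)
    (k : Type) [Field k] [ValuativeRel k] [TopologicalSpace k] [IsNonarchimedeanLocalField k] [CharZero k]
    (k₁ : Type) [Field k₁] [ValuativeRel k₁] [TopologicalSpace k₁] [IsNonarchimedeanLocalField k₁] [CharZero k₁]
    (β : absoluteGaloisGroup k₁ →ₜ* absoluteGaloisGroup k) (hinj : Injective β) (hopen : IsOpen (Set.range β))
    (x : galCyclotomeH2 (absoluteGaloisGroup k)) :
    r k₁ ((galCyclotomeResOE β hinj hopen 2).hom x) = β.toMonoidHom.range.index • r k x := by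
  classical
  obtain ⟨L, hL, α, g, hβ, hidx⟩ := exists_eq_conj_absGaloisRestrict_comp β hinj hopen
  -- `L ⊆ k̄` finite over `k` is a local field (any choice of its structure would do)
  letI := FiniteExtension.valuativeRel k L
  letI := FiniteExtension.topologicalSpace k L
  haveI : IsNonarchimedeanLocalField L := FiniteExtension.isNonarchimedeanLocalField k L
  haveI : CharZero L := charZero_of_injective_algebraMap (algebraMap k L).injective
  rw [galCyclotomeResOE_factorisation_apply β hinj hopen L α g hβ (Or.inr rfl) x]
  change r k₁ (galCyclotomeCohomologyMap α.symm 2 ((galCyclotomeRes k L 2).hom x)) = _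
  rw [hiso L k₁ α.symm, hres k L x, hidx]

/-- **THE family (a) of abc-iut-L4-d1 (`Cor110iaNat.residueIso`) along ARBITRARY injective open
homomorphisms**: `r_{k₁} (Res_β x) = [G_k : β(G_{k₁})] · r_k x` for every injective open
`β : G_{k₁} ↪ G_k` — Cor. 1.10 (i)(a) with Rmk. 1.10.1 (iii), print-literal, unconditional.
[cite: MochizukiAbsTopIII2015, Remark 1.10.1 p.44] -/
theorem Cor110iaNat.residueIso_galCyclotomeResOE
    (k : Type) [Field k] [ValuativeRel k] [TopologicalSpace k] [IsNonarchimedeanLocalField k] [CharZero k]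
    (k₁ : Type) [Field k₁] [ValuativeRel k₁] [TopologicalSpace k₁] [IsNonarchimedeanLocalField k₁] [CharZero k₁]
    (β : absoluteGaloisGroup k₁ →ₜ* absoluteGaloisGroup k) (hinj : Injective β) (hopen : IsOpen (Set.range β))
    (x : galCyclotomeH2 (absoluteGaloisGroup k)) :
    Cor110iaNat.residueIso k₁ ((galCyclotomeResOE β hinj hopen 2).hom x) =
      β.toMonoidHom.range.index • Cor110iaNat.residueIso k x := by
  exact residueFamily_galCyclotomeResOE (fun k _ _ _ _ _ => Cor110iaNat.residueIso k)
    (fun _ _ _ _ _ _ _ _ _ _ _ _ α x => Cor110iaNat.residueIso_natural α x)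
    (fun k _ _ _ _ _ k' _ _ _ _ _ _ _ x => Cor110iaNat.residueIso_galCyclotomeRes_of_compatible k k'
      (fun y => Cor110Open.levelChar_equiv_eq_inducedCyclotomeEquiv k k' y) x)
    k k₁ β hinj hopen x

namespace AbsTopIII

/-- **[AbsTopIII] Cor. 1.10 (i)(a), PRINT-LITERAL: natural along ARBITRARY injective open homomorphisms
«up to the index», unconditional.**  There is a family `r_k : H²(G_k, μ_Ẑ(G_k)) ≃ Ẑ` (THE family
`Cor110iaNat.residueIso`) with (1) the residue levelwise, (2) naturality in isomorphisms of topological groups,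
(3) the index formula along finite extensions `k′/k`, and (4) for EVERY injective open homomorphism
`β : G_{k₁} ↪ G_k` of absolute Galois groups of MLFs, `r_{k₁} ∘ Res_β = [G_k : β(G_{k₁})] · r_k`
(`Res_β = galCyclotomeResOE β 2`). [cite: MochizukiAbsTopIII2015, Remark 1.10.1 p.44] -/
theorem cor_1_10_i_a_openInjective :
    ∃ r : ∀ (k : Type) [Field k] [ValuativeRel k] [TopologicalSpace k] [IsNonarchimedeanLocalField k]
        [CharZero k], galCyclotomeH2 (absoluteGaloisGroup k) ≃+ Additive (completion (GrpCat.of (Multiplicative ℤ))),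
      (∀ (k : Type) [Field k] [ValuativeRel k] [TopologicalSpace k] [IsNonarchimedeanLocalField k]
        [CharZero k],
        ∃ (φ : muQZ (absoluteGaloisGroup k) ≃+ Additive (CommGroup.torsion (AlgebraicClosure k)ˣ))
          (hφ : ∀ (σ : absoluteGaloisGroup k) (x : muQZ (absoluteGaloisGroup k)),
            (((Additive.toMul (φ (σ • x)) : CommGroup.torsion (AlgebraicClosure k)ˣ) :
                (AlgebraicClosure k)ˣ) : AlgebraicClosure k) =
              σ • (((Additive.toMul (φ x) : CommGroup.torsion (AlgebraicClosure k)ˣ) :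
                (AlgebraicClosure k)ˣ) : AlgebraicClosure k)),
          ∀ (x : galCyclotomeH2 (absoluteGaloisGroup k)) (n : ℕ+),
            Multiplicative.toAdd (level n (Additive.toMul (r k x))) =
              invMap k n (cohomologyMap ((muSystem k).projHom n) 2
                ((cohomologyMap (galCyclotomeIsoTateModule k φ hφ).hom 2).hom x))) ∧
      (∀ (k₁ : Type) [Field k₁] [ValuativeRel k₁] [TopologicalSpace k₁] [IsNonarchimedeanLocalField k₁]
        [CharZero k₁]
        (k₂ : Type) [Field k₂] [ValuativeRel k₂] [TopologicalSpace k₂] [IsNonarchimedeanLocalField k₂]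
        [CharZero k₂]
        (α : absoluteGaloisGroup k₁ ≃ₜ* absoluteGaloisGroup k₂) (x : galCyclotomeH2 (absoluteGaloisGroup k₁)),
        r k₂ (galCyclotomeCohomologyMap α 2 x) = r k₁ x) ∧
      (∀ (k : Type) [Field k] [ValuativeRel k] [TopologicalSpace k] [IsNonarchimedeanLocalField k] [CharZero k]
        (k' : Type) [Field k'] [ValuativeRel k'] [TopologicalSpace k'] [IsNonarchimedeanLocalField k'] [CharZero k']
        [Algebra k k'] [FiniteDimensional k k'] (x : galCyclotomeH2 (absoluteGaloisGroup k)),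
        r k' ((galCyclotomeRes k k' 2).hom x) = (Module.finrank k k') • r k x) ∧
      ∀ (k : Type) [Field k] [ValuativeRel k] [TopologicalSpace k] [IsNonarchimedeanLocalField k] [CharZero k]
        (k₁ : Type) [Field k₁] [ValuativeRel k₁] [TopologicalSpace k₁] [IsNonarchimedeanLocalField k₁] [CharZero k₁]
        (β : absoluteGaloisGroup k₁ →ₜ* absoluteGaloisGroup k) (hinj : Injective β) (hopen : IsOpen (Set.range β))
        (x : galCyclotomeH2 (absoluteGaloisGroup k)),
        r k₁ ((galCyclotomeResOE β hinj hopen 2).hom x) = β.toMonoidHom.range.index • r k x := by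
  obtain ⟨r, h1, h2, h3⟩ := cor_1_10_i_a_resNatural_holds
  exact ⟨r, h1, h2, h3, fun k _ _ _ _ _ k₁ _ _ _ _ _ β hinj hopen x =>
    residueFamily_galCyclotomeResOE r h2 h3 k k₁ β hinj hopen x⟩

end AbsTopIII

end ResidueFamily

/-! ### §4. (b): the reciprocity family along arbitrary injective open homomorphisms -/

section ReciprocityFamily

/-- **(b) along ARBITRARY injective open homomorphisms.**  ANY family
`j_k : H¹(G_k, μ_Ẑ(G_k)) ≃ G_k^ab` (indexed by MLFs) natural in isomorphisms of topological groups and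
compatible with restriction/Verlagerung along finite extensions satisfies, for every injective open
`β : G_{k₁} ↪ G_k` and every factorisation `β = Inn(g) ∘ res_{L/k} ∘ α` (`α : G_{k₁} ⥲ G_L`; one always
exists, `exists_eq_conj_absGaloisRestrict_comp`), `j_{k₁} (Res_β x) = (α⁻¹)^ab (Ver_{L/k} (j_k x))` — the
transfer to the image followed by the identification of the image with `G_{k₁}`, inner automorphisms acting
trivially. [cite: MochizukiAbsTopIII2015, Cor 1.10 (i) p.42] -/
theorem reciprocityFamily_galCyclotomeResOE
    (j : ∀ (k : Type) [Field k] [ValuativeRel k] [TopologicalSpace k] [IsNonarchimedeanLocalField k]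
      [CharZero k], galCyclotomeH1 (absoluteGaloisGroup k) ≃+ Additive (absoluteGaloisGroupAbelianization k))
    (hiso : ∀ (k₁ : Type) [Field k₁] [ValuativeRel k₁] [TopologicalSpace k₁] [IsNonarchimedeanLocalField k₁]
      [CharZero k₁]
      (k₂ : Type) [Field k₂] [ValuativeRel k₂] [TopologicalSpace k₂] [IsNonarchimedeanLocalField k₂]
      [CharZero k₂]
      (α : absoluteGaloisGroup k₁ ≃ₜ* absoluteGaloisGroup k₂) (x : galCyclotomeH1 (absoluteGaloisGroup k₁)),
      j k₂ (galCyclotomeH1Map α x) = Additive.ofMul (abelianizationCongr α (Additive.toMul (j k₁ x))))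
    (hres : ∀ (k : Type) [Field k] [ValuativeRel k] [TopologicalSpace k] [IsNonarchimedeanLocalField k]
      [CharZero k]
      (k' : Type) [Field k'] [ValuativeRel k'] [TopologicalSpace k'] [IsNonarchimedeanLocalField k'] [CharZero k']
      [Algebra k k'] [FiniteDimensional k k'] (x : galCyclotomeH1 (absoluteGaloisGroup k)),
      j k' ((galCyclotomeRes k k' 1).hom x) = Additive.ofMul
          (Literature.NumberTheory.GaloisRepresentations.verlagerung k k' (Additive.toMul (j k x))))
    (k : Type) [Field k] [ValuativeRel k] [TopologicalSpace k] [IsNonarchimedeanLocalField k] [CharZero k]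
    (k₁ : Type) [Field k₁] [ValuativeRel k₁] [TopologicalSpace k₁] [IsNonarchimedeanLocalField k₁] [CharZero k₁]
    (β : absoluteGaloisGroup k₁ →ₜ* absoluteGaloisGroup k) (hinj : Injective β) (hopen : IsOpen (Set.range β))
    (L : IntermediateField k (AlgebraicClosure k)) [FiniteDimensional k L]
    (α : absoluteGaloisGroup k₁ ≃ₜ* absoluteGaloisGroup L) (g : absoluteGaloisGroup k)
    (hβ : ∀ σ, β σ = g * absGaloisRestrict k L (α σ) * g⁻¹) (x : galCyclotomeH1 (absoluteGaloisGroup k)) :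
    j k₁ ((galCyclotomeResOE β hinj hopen 1).hom x) =
      Additive.ofMul (abelianizationCongr α.symm
        (Literature.NumberTheory.GaloisRepresentations.verlagerung k L (Additive.toMul (j k x)))) := by
  classical
  letI := FiniteExtension.valuativeRel k L
  letI := FiniteExtension.topologicalSpace k L
  haveI : IsNonarchimedeanLocalField L := FiniteExtension.isNonarchimedeanLocalField k L
  haveI : CharZero L := charZero_of_injective_algebraMap (algebraMap k L).injective
  rw [galCyclotomeResOE_factorisation_apply β hinj hopen L α g hβ (Or.inl rfl) x]
  change j k₁ (galCyclotomeH1Map α.symm ((galCyclotomeRes k L 1).hom x)) = _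
  rw [hiso L k₁ α.symm, hres k L x, toMul_ofMul]

namespace AbsTopIII

/-- **[AbsTopIII] Cor. 1.10 (i)(b), PRINT-LITERAL: natural along ARBITRARY injective open homomorphisms,
unconditional.**  There is a family `j_k : H¹(G_k, μ_Ẑ(G_k)) ≃ G_k^ab` (THE family of
`cor_1_10_i_b_resNatural_holds`) with (1) `j_k ∘ H¹(φ)⁻¹ ∘ κ̂` a local reciprocity map, (2) naturality in
isomorphisms, (3) restriction-vs-Verlagerung along every finite `k′/k`, and (4) for EVERY injective open
`β : G_{k₁} ↪ G_k` and every factorisation `β = Inn(g) ∘ res_{L/k} ∘ α` (which always exists,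
`exists_eq_conj_absGaloisRestrict_comp`): `j_{k₁} ∘ Res_β = (α⁻¹)^ab ∘ Ver_{L/k} ∘ j_k`
(`Res_β = galCyclotomeResOE β 1`). [cite: MochizukiAbsTopIII2015, Cor 1.10 (i) p.42] -/
theorem cor_1_10_i_b_openInjective :
    ∃ j : ∀ (k : Type) [Field k] [ValuativeRel k] [TopologicalSpace k] [IsNonarchimedeanLocalField k]
        [CharZero k],
        galCyclotomeH1 (absoluteGaloisGroup k) ≃+ Additive (absoluteGaloisGroupAbelianization k),
      (∀ (k : Type) [Field k] [ValuativeRel k] [TopologicalSpace k] [IsNonarchimedeanLocalField k]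
        [CharZero k],
        ∃ (φ : muQZ (absoluteGaloisGroup k) ≃+ Additive (CommGroup.torsion (AlgebraicClosure k)ˣ))
          (hφ : ∀ (σ : absoluteGaloisGroup k) (x : muQZ (absoluteGaloisGroup k)),
            (((Additive.toMul (φ (σ • x)) : CommGroup.torsion (AlgebraicClosure k)ˣ) :
                (AlgebraicClosure k)ˣ) : AlgebraicClosure k) =
              σ • (((Additive.toMul (φ x) : CommGroup.torsion (AlgebraicClosure k)ˣ) :
                (AlgebraicClosure k)ˣ) : AlgebraicClosure k)),
          IsLocalReciprocityMap k (reciprocityOfContainerIso hφ (j k))) ∧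
      (∀ (k₁ : Type) [Field k₁] [ValuativeRel k₁] [TopologicalSpace k₁] [IsNonarchimedeanLocalField k₁]
        [CharZero k₁]
        (k₂ : Type) [Field k₂] [ValuativeRel k₂] [TopologicalSpace k₂] [IsNonarchimedeanLocalField k₂]
        [CharZero k₂]
        (α : absoluteGaloisGroup k₁ ≃ₜ* absoluteGaloisGroup k₂) (x : galCyclotomeH1 (absoluteGaloisGroup k₁)),
        j k₂ (galCyclotomeH1Map α x) = Additive.ofMul (abelianizationCongr α (Additive.toMul (j k₁ x)))) ∧
      (∀ (k : Type) [Field k] [ValuativeRel k] [TopologicalSpace k] [IsNonarchimedeanLocalField k] [CharZero k]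
        (k' : Type) [Field k'] [ValuativeRel k'] [TopologicalSpace k'] [IsNonarchimedeanLocalField k']
        [CharZero k'] [Algebra k k'] [FiniteDimensional k k'] (x : galCyclotomeH1 (absoluteGaloisGroup k)),
        j k' ((galCyclotomeRes k k' 1).hom x) = Additive.ofMul
          (Literature.NumberTheory.GaloisRepresentations.verlagerung k k' (Additive.toMul (j k x)))) ∧
      ∀ (k : Type) [Field k] [ValuativeRel k] [TopologicalSpace k] [IsNonarchimedeanLocalField k] [CharZero k]
        (k₁ : Type) [Field k₁] [ValuativeRel k₁] [TopologicalSpace k₁] [IsNonarchimedeanLocalField k₁] [CharZero k₁]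
        (β : absoluteGaloisGroup k₁ →ₜ* absoluteGaloisGroup k) (hinj : Injective β) (hopen : IsOpen (Set.range β))
        (L : IntermediateField k (AlgebraicClosure k)) [FiniteDimensional k L]
        (α : absoluteGaloisGroup k₁ ≃ₜ* absoluteGaloisGroup L) (g : absoluteGaloisGroup k),
        (∀ σ, β σ = g * absGaloisRestrict k L (α σ) * g⁻¹) → ∀ x : galCyclotomeH1 (absoluteGaloisGroup k),
          j k₁ ((galCyclotomeResOE β hinj hopen 1).hom x) =
            Additive.ofMul (abelianizationCongr α.symm
        (Literature.NumberTheory.GaloisRepresentations.verlagerung k L (Additive.toMul (j k x)))) := by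
  obtain ⟨j, h1, h2, h3⟩ := cor_1_10_i_b_resNatural_holds
  exact ⟨j, h1, h2, h3, fun k _ _ _ _ _ k₁ _ _ _ _ _ β hinj hopen L _ α g hβ x =>
    reciprocityFamily_galCyclotomeResOE j h2 h3 k k₁ β hinj hopen L α g hβ x⟩

end AbsTopIII

end ReciprocityFamily

end Literature.AnabelianGeometry.AbsoluteAnabelian
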